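import Mathlib
import HarnessLib
import Summits.KontsevichZagierPeriods.Zeta5Search.VWPBarnesShift

/-!
# ζ(5) search — the far vertical line of the `F_m` Barnes integral tends to zero (cell `pub-zeta5`, ct-1 g28)

HONEST FRAMING: systematic search; no irrationality claim unless kernel-certified.  Elementary estimates for a Mellin–Barnes
integrand (special functions); nothing here is an irrationality result, a worthiness exponent or a denominator statement; no named
fact is discharged; no definition is introduced.

Fourth piece of brick B4 of `HOME/ct-1/g27/VWP-BLUEPRINT-g27.md`.  With the kernel `V(s)` of `VWPBarnesKernel` and the weighted
integrand `F(s) = V(s) e^{iεπs} w^s` of `VWPBarnesShift`, we show WITHOUT any uniform Stirling estimate that for `0 < w < 1`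

  `∫ F(N + ½ + iy) dy → 0`  as `N → ∞`                                             (`tendsto_integral_far`).

The device is the one-step ratio `R(s) = V(s+1)/V(s) = [(h₀+2s+2)/(h₀+2s)] · ∏_{j≤m}(h_j+s) / ((−s−1)∏_{j<m}(1+h₀−h_{j+1}+s))`
(from `Γ(z+1) = zΓ(z)`), a rational function of degree `0` with `sup_{Re s = σ} ‖R(s)‖ → 1` as `σ → ∞` (`norm_ratio_le`,
`norm_kernelRatio_le`, `exists_kernelRatio_le`): hence `J(σ) = ∫ ‖V e^{iεπs}‖_{Re s = σ} dy` satisfies `J(σ+1) ≤ (1+δ)J(σ)`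
(`integral_norm_succ_le`), so `w^N J(N+½)` decays geometrically once `w(1+δ) < 1`.

Theorems only; imports `Zeta5Search/VWPBarnesShift`.
-/

noncomputable section

namespace Summit.KontsevichZagierPeriods.Zeta5Search.VWPBarnesFarLine

open MeasureTheory Set Filter
open scoped Real Topology
open Summit.KontsevichZagierPeriods.Zeta5Search.VWPBarnesShift
open Summit.KontsevichZagierPeriods.Zeta5Search.VWPBarnesKernelUniform (line_ne_nat)

variable {m : ℕ} {h : ℕ → ℂ} {ε w : ℝ}

/-! ### 1. The one-step ratio -/

/-- Generic factor bound: for `‖β‖ < Re s`, `‖(α + s)/(β + s)‖ ≤ 1 + ‖α − β‖/(Re s − ‖β‖)`. -/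
theorem norm_ratio_le (α β : ℂ) {s : ℂ} (hs : ‖β‖ < s.re) :
    ‖(α + s) / (β + s)‖ ≤ 1 + ‖α - β‖ / (s.re - ‖β‖) := by
  have hβs : s.re - ‖β‖ ≤ ‖β + s‖ := by
    have h1 : (β + s).re ≤ ‖β + s‖ := Complex.re_le_norm _
    have h2 : -‖β‖ ≤ β.re := by
      have := Complex.abs_re_le_norm β; rw [abs_le] at this; exact this.1
    simp only [Complex.add_re] at h1; linarith
  have hpos : 0 < s.re - ‖β‖ := by linarith
  have hne : β + s ≠ 0 := norm_pos_iff.mp (lt_of_lt_of_le hpos hβs)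
  have hid : (α + s) / (β + s) = 1 + (α - β) / (β + s) := by field_simp; ring
  rw [hid]
  calc ‖1 + (α - β) / (β + s)‖ ≤ ‖(1 : ℂ)‖ + ‖(α - β) / (β + s)‖ := norm_add_le _ _
    _ = 1 + ‖α - β‖ / ‖β + s‖ := by rw [norm_one, norm_div]
    _ ≤ 1 + ‖α - β‖ / (s.re - ‖β‖) := by gcongr

/-- **The functional equation of the kernel**: `V(s+1) = V(s) · R(s)` with
`R(s) = [(h₀+2s+2)/(h₀+2s)] · ∏_{j≤m}(h_j+s) / ((−s−1) ∏_{j<m}(1+h₀−h_{j+1}+s))`, whenever no factor vanishes. -/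
theorem kernel_add_one (m : ℕ) (h : ℕ → ℂ) {s : ℂ} (h0s : h 0 + 2 * s ≠ 0) (hs1 : s + 1 ≠ 0)
    (hnum : ∀ j, j ≤ m → h j + s ≠ 0) (hden : ∀ j, j < m → 1 + h 0 - h (j + 1) + s ≠ 0)
    (hΓden : ∀ j, j < m → Complex.Gamma (1 + h 0 - h (j + 1) + s) ≠ 0) :
    (h 0 + 2 * (s + 1)) * (∏ j ∈ Finset.range (m + 1), Complex.Gamma (h j + (s + 1))) * Complex.Gamma (-(s + 1)) /
        ∏ j ∈ Finset.range m, Complex.Gamma (1 + h 0 - h (j + 1) + (s + 1)) =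
      (h 0 + 2 * s) * (∏ j ∈ Finset.range (m + 1), Complex.Gamma (h j + s)) * Complex.Gamma (-s) /
          (∏ j ∈ Finset.range m, Complex.Gamma (1 + h 0 - h (j + 1) + s)) *
        ((h 0 + 2 * s + 2) / (h 0 + 2 * s) *
          ((∏ j ∈ Finset.range (m + 1), (h j + s)) / ((-s - 1) * ∏ j ∈ Finset.range m, (1 + h 0 - h (j + 1) + s)))) := by
  have e1 : ∀ j ∈ Finset.range (m + 1), Complex.Gamma (h j + (s + 1)) = (h j + s) * Complex.Gamma (h j + s) := by
    intro j hj
    rw [show h j + (s + 1) = h j + s + 1 by ring]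
    exact Complex.Gamma_add_one _ (hnum j (by simpa [Nat.lt_succ_iff] using hj))
  have e2 : ∀ j ∈ Finset.range m, Complex.Gamma (1 + h 0 - h (j + 1) + (s + 1)) =
      (1 + h 0 - h (j + 1) + s) * Complex.Gamma (1 + h 0 - h (j + 1) + s) := by
    intro j hj
    rw [show 1 + h 0 - h (j + 1) + (s + 1) = 1 + h 0 - h (j + 1) + s + 1 by ring]
    exact Complex.Gamma_add_one _ (hden j (by simpa using hj))
  have hs1' : -s - 1 ≠ 0 := by
    intro h0; apply hs1; linear_combination -h0
  have e3 : Complex.Gamma (-(s + 1)) = Complex.Gamma (-s) / (-s - 1) := by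
    have : Complex.Gamma (-s) = (-s - 1) * Complex.Gamma (-(s + 1)) := by
      rw [show -s = -(s + 1) + 1 by ring, Complex.Gamma_add_one _ (by rwa [neg_ne_zero])]
      ring
    rw [this]; field_simp
  have hP : ∏ j ∈ Finset.range m, (1 + h 0 - h (j + 1) + s) ≠ 0 :=
    Finset.prod_ne_zero_iff.2 fun j hj => hden j (by simpa using hj)
  have hQ : ∏ j ∈ Finset.range m, Complex.Gamma (1 + h 0 - h (j + 1) + s) ≠ 0 :=
    Finset.prod_ne_zero_iff.2 fun j hj => hΓden j (by simpa using hj)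
  rw [Finset.prod_congr rfl e1, Finset.prod_congr rfl e2, Finset.prod_mul_distrib, Finset.prod_mul_distrib, e3]
  field_simp
  ring

/-- The ratio in product form: `R(s) = [(h₀+2+2s)/(h₀+2s)] · [−(h₀+s)/(1+s)] · ∏_{j<m} (h_{j+1}+s)/(1+h₀−h_{j+1}+s)`. -/
theorem kernelRatio_eq (m : ℕ) (h : ℕ → ℂ) (s : ℂ) :
    (h 0 + 2 * s + 2) / (h 0 + 2 * s) *
        ((∏ j ∈ Finset.range (m + 1), (h j + s)) / ((-s - 1) * ∏ j ∈ Finset.range m, (1 + h 0 - h (j + 1) + s))) =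
      (h 0 + 2 + 2 * s) / (h 0 + 2 * s) * -((h 0 + s) / (1 + s)) *
        ∏ j ∈ Finset.range m, (h (j + 1) + s) / (1 + h 0 - h (j + 1) + s) := by
  rw [Finset.prod_range_succ' (fun j => h j + s), Finset.prod_div_distrib,
    show (-s - 1) = -(1 + s) by ring]
  rw [show (h 0 + 2 * s + 2) = (h 0 + 2 + 2 * s) by ring]
  generalize (∏ j ∈ Finset.range m, (h (j + 1) + s)) = A
  generalize (∏ j ∈ Finset.range m, (1 + h 0 - h (j + 1) + s)) = B
  rw [mul_comm (-(1 + s)) B, ← div_div, div_neg]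
  ring

/-- **The ratio bound**: for `Re s > T = 1 + Σ_{j≤m}‖h_j‖ + Σ_{j<m}‖1+h₀−h_{j+1}‖`,
`‖R(s)‖ ≤ (1 + 2/(2 Re s − ‖h₀‖)) (1 + ‖h₀−1‖/(Re s − 1)) ∏_{j<m} (1 + ‖2h_{j+1}−1−h₀‖/(Re s − ‖1+h₀−h_{j+1}‖))`. -/
theorem norm_kernelRatio_le (m : ℕ) (h : ℕ → ℂ) {s : ℂ}
    (hs : 1 + (∑ j ∈ Finset.range (m + 1), ‖h j‖) + (∑ j ∈ Finset.range m, ‖1 + h 0 - h (j + 1)‖) < s.re) :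
    ‖(h 0 + 2 * s + 2) / (h 0 + 2 * s) *
        ((∏ j ∈ Finset.range (m + 1), (h j + s)) / ((-s - 1) * ∏ j ∈ Finset.range m, (1 + h 0 - h (j + 1) + s)))‖ ≤
      (1 + 2 / (2 * s.re - ‖h 0‖)) * (1 + ‖h 0 - 1‖ / (s.re - 1)) *
        ∏ j ∈ Finset.range m, (1 + ‖h (j + 1) - (1 + h 0 - h (j + 1))‖ / (s.re - ‖1 + h 0 - h (j + 1)‖)) := by
  have hsum1 : 0 ≤ ∑ j ∈ Finset.range (m + 1), ‖h j‖ := Finset.sum_nonneg fun _ _ => norm_nonneg _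
  have hsum2 : 0 ≤ ∑ j ∈ Finset.range m, ‖1 + h 0 - h (j + 1)‖ := Finset.sum_nonneg fun _ _ => norm_nonneg _
  have hh0 : ‖h 0‖ ≤ ∑ j ∈ Finset.range (m + 1), ‖h j‖ :=
    Finset.single_le_sum (f := fun j => ‖h j‖) (fun _ _ => norm_nonneg _) (by simp)
  have hdenj : ∀ j ∈ Finset.range m, ‖1 + h 0 - h (j + 1)‖ ≤ ∑ i ∈ Finset.range m, ‖1 + h 0 - h (i + 1)‖ := fun j hj =>
    Finset.single_le_sum (f := fun i => ‖1 + h 0 - h (i + 1)‖) (fun _ _ => norm_nonneg _) hj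
  rw [kernelRatio_eq, norm_mul, norm_mul, norm_neg, norm_prod]
  -- the three kinds of factors
  have b1 : ‖(h 0 + 2 + 2 * s) / (h 0 + 2 * s)‖ ≤ 1 + 2 / (2 * s.re - ‖h 0‖) := by
    have := norm_ratio_le (h 0 + 2) (h 0) (s := 2 * s) (by simp; linarith)
    simp only [add_sub_cancel_left, Complex.norm_two, Complex.mul_re, Complex.re_ofNat, Complex.im_ofNat, zero_mul,
      sub_zero] at this
    exact this
  have b2 : ‖(h 0 + s) / (1 + s)‖ ≤ 1 + ‖h 0 - 1‖ / (s.re - 1) := by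
    have := norm_ratio_le (h 0) 1 (s := s) (by simp; linarith)
    simpa using this
  have b3 : ∀ j ∈ Finset.range m, ‖(h (j + 1) + s) / (1 + h 0 - h (j + 1) + s)‖ ≤
      1 + ‖h (j + 1) - (1 + h 0 - h (j + 1))‖ / (s.re - ‖1 + h 0 - h (j + 1)‖) := fun j hj =>
    norm_ratio_le (h (j + 1)) (1 + h 0 - h (j + 1)) (by linarith [hdenj j hj])
  have hb1 : 0 ≤ 1 + 2 / (2 * s.re - ‖h 0‖) := by
    have : 0 < 2 * s.re - ‖h 0‖ := by linarith
    positivity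
  exact mul_le_mul (mul_le_mul b1 b2 (norm_nonneg _) hb1) (Finset.prod_le_prod (fun _ _ => norm_nonneg _) b3)
    (Finset.prod_nonneg fun _ _ => norm_nonneg _) (mul_nonneg hb1 (le_trans (norm_nonneg _) b2))

/-- `1 + c/(kσ − d) → 1` as `σ → ∞` (`k > 0`). -/
theorem tendsto_one_add_div (c d : ℝ) {k : ℝ} (hk : 0 < k) :
    Tendsto (fun σ : ℝ => 1 + c / (k * σ - d)) atTop (𝓝 1) := by
  have h1 : Tendsto (fun σ : ℝ => k * σ - d) atTop atTop := by
    have := tendsto_atTop_add_const_right atTop (-d) (tendsto_id.const_mul_atTop hk)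
    simpa [sub_eq_add_neg] using this
  have h2 : Tendsto (fun σ : ℝ => c / (k * σ - d)) atTop (𝓝 0) := tendsto_const_nhds.div_atTop h1
  simpa using tendsto_const_nhds.add h2

/-- **`sup_{Re s = σ} ‖R(s)‖ → 1`**: for every `δ > 0` there is `σ₀` beyond all the thresholds with `‖R(s)‖ ≤ 1 + δ` for `Re s ≥ σ₀`. -/
theorem exists_kernelRatio_le (m : ℕ) (h : ℕ → ℂ) {δ : ℝ} (hδ : 0 < δ) :
    ∃ σ₀ : ℝ, 1 + (∑ j ∈ Finset.range (m + 1), ‖h j‖) + (∑ j ∈ Finset.range m, ‖1 + h 0 - h (j + 1)‖) < σ₀ ∧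
      ∀ s : ℂ, σ₀ ≤ s.re →
        ‖(h 0 + 2 * s + 2) / (h 0 + 2 * s) *
            ((∏ j ∈ Finset.range (m + 1), (h j + s)) / ((-s - 1) * ∏ j ∈ Finset.range m, (1 + h 0 - h (j + 1) + s)))‖ ≤
          1 + δ := by
  set T : ℝ := 1 + (∑ j ∈ Finset.range (m + 1), ‖h j‖) + (∑ j ∈ Finset.range m, ‖1 + h 0 - h (j + 1)‖) with hT
  set bnd : ℝ → ℝ := fun σ => (1 + 2 / (2 * σ - ‖h 0‖)) * (1 + ‖h 0 - 1‖ / (σ - 1)) *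
    ∏ j ∈ Finset.range m, (1 + ‖h (j + 1) - (1 + h 0 - h (j + 1))‖ / (σ - ‖1 + h 0 - h (j + 1)‖)) with hbnd
  have hlim : Tendsto bnd atTop (𝓝 1) := by
    have e1 := tendsto_one_add_div 2 ‖h 0‖ (k := 2) two_pos
    have e2 : Tendsto (fun σ : ℝ => 1 + ‖h 0 - 1‖ / (σ - 1)) atTop (𝓝 1) := by
      simpa using tendsto_one_add_div ‖h 0 - 1‖ 1 (k := 1) one_pos
    have e3 : Tendsto (fun σ : ℝ => ∏ j ∈ Finset.range m,
        (1 + ‖h (j + 1) - (1 + h 0 - h (j + 1))‖ / (σ - ‖1 + h 0 - h (j + 1)‖))) atTop (𝓝 (∏ j ∈ Finset.range m, (1 : ℝ))) :=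
      tendsto_finsetProd _ fun j _ => by
        simpa using tendsto_one_add_div ‖h (j + 1) - (1 + h 0 - h (j + 1))‖ ‖1 + h 0 - h (j + 1)‖ (k := 1) one_pos
    have := (e1.mul e2).mul e3
    simpa [hbnd] using this
  have hev := (hlim.eventually (Iio_mem_nhds (by linarith : (1 : ℝ) < 1 + δ))).and (eventually_gt_atTop T)
  obtain ⟨σ₀, hσ₀⟩ := eventually_atTop.1 hev
  refine ⟨σ₀, (hσ₀ σ₀ le_rfl).2, fun s hs => ?_⟩
  have h1 := hσ₀ s.re hs
  exact (norm_kernelRatio_le m h h1.2).trans (le_of_lt h1.1)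

/-! ### 2. The recursion for the line integrals -/

/-- Beyond the threshold no factor vanishes: the hypotheses of `kernel_add_one` at `s`, and the pole-freeness of the line `Re s`. -/
theorem kernel_hyps {m : ℕ} {h : ℕ → ℂ} {s : ℂ}
    (hs : 1 + (∑ j ∈ Finset.range (m + 1), ‖h j‖) + (∑ j ∈ Finset.range m, ‖1 + h 0 - h (j + 1)‖) < s.re) :
    h 0 + 2 * s ≠ 0 ∧ s + 1 ≠ 0 ∧ (∀ j, j ≤ m → h j + s ≠ 0) ∧ (∀ j, j < m → 1 + h 0 - h (j + 1) + s ≠ 0) ∧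
      (∀ j, j < m → Complex.Gamma (1 + h 0 - h (j + 1) + s) ≠ 0) := by
  have hsum1 : 0 ≤ ∑ j ∈ Finset.range (m + 1), ‖h j‖ := Finset.sum_nonneg fun _ _ => norm_nonneg _
  have hsum2 : 0 ≤ ∑ j ∈ Finset.range m, ‖1 + h 0 - h (j + 1)‖ := Finset.sum_nonneg fun _ _ => norm_nonneg _
  have hhj : ∀ j, j ≤ m → ‖h j‖ ≤ ∑ i ∈ Finset.range (m + 1), ‖h i‖ := fun j hj =>
    Finset.single_le_sum (f := fun i => ‖h i‖) (fun _ _ => norm_nonneg _) (by simpa [Nat.lt_succ_iff] using hj)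
  have hdenj : ∀ j, j < m → ‖1 + h 0 - h (j + 1)‖ ≤ ∑ i ∈ Finset.range m, ‖1 + h 0 - h (i + 1)‖ := fun j hj =>
    Finset.single_le_sum (f := fun i => ‖1 + h 0 - h (i + 1)‖) (fun _ _ => norm_nonneg _) (by simpa using hj)
  have hre : ∀ c : ℂ, -‖c‖ ≤ c.re := fun c => by
    have := Complex.abs_re_le_norm c; rw [abs_le] at this; exact this.1
  have hne : ∀ z : ℂ, 0 < z.re → z ≠ 0 := fun z hz h0 => by rw [h0] at hz; simp at hz
  refine ⟨hne _ ?_, hne _ ?_, fun j hj => hne _ ?_, fun j hj => hne _ ?_, fun j hj => Complex.Gamma_ne_zero_of_re_pos ?_⟩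
  · simp; linarith [hre (h 0), hhj 0 (Nat.zero_le _)]
  · simp; linarith
  · simp; linarith [hre (h j), hhj j hj]
  · have h1 := hre (1 + h 0 - h (j + 1))
    simp only [Complex.add_re, Complex.sub_re, Complex.one_re] at h1
    simp; linarith [hdenj j hj]
  · have h1 := hre (1 + h 0 - h (j + 1))
    simp only [Complex.add_re, Complex.sub_re, Complex.one_re] at h1
    simp; linarith [hdenj j hj]

/-- **One step of the recursion, pointwise**: `‖V(s+1) e^{iεπ(s+1)}‖ ≤ (1+δ) ‖V(s) e^{iεπs}‖` beyond the threshold `σ₀` of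
`exists_kernelRatio_le`. -/
theorem norm_kernel_phase_succ_le (m : ℕ) (h : ℕ → ℂ) (ε : ℝ) {δ σ₀ : ℝ}
    (hT : 1 + (∑ j ∈ Finset.range (m + 1), ‖h j‖) + (∑ j ∈ Finset.range m, ‖1 + h 0 - h (j + 1)‖) < σ₀)
    (hR : ∀ s : ℂ, σ₀ ≤ s.re →
        ‖(h 0 + 2 * s + 2) / (h 0 + 2 * s) *
            ((∏ j ∈ Finset.range (m + 1), (h j + s)) / ((-s - 1) * ∏ j ∈ Finset.range m, (1 + h 0 - h (j + 1) + s)))‖ ≤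
          1 + δ)
    {s : ℂ} (hs : σ₀ ≤ s.re) :
    ‖(h 0 + 2 * (s + 1)) * (∏ j ∈ Finset.range (m + 1), Complex.Gamma (h j + (s + 1))) * Complex.Gamma (-(s + 1)) /
          (∏ j ∈ Finset.range m, Complex.Gamma (1 + h 0 - h (j + 1) + (s + 1))) *
        Complex.exp (ε * π * Complex.I * (s + 1))‖ ≤
      (1 + δ) * ‖(h 0 + 2 * s) * (∏ j ∈ Finset.range (m + 1), Complex.Gamma (h j + s)) * Complex.Gamma (-s) /
          (∏ j ∈ Finset.range m, Complex.Gamma (1 + h 0 - h (j + 1) + s)) * Complex.exp (ε * π * Complex.I * s)‖ := by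
  obtain ⟨h0s, hs1, hnum, hden, hΓden⟩ := kernel_hyps (m := m) (h := h) (lt_of_lt_of_le hT hs)
  have hphase : Complex.exp (ε * π * Complex.I * (s + 1)) = Complex.exp (ε * π * Complex.I * s) * Complex.exp (ε * π * Complex.I) := by
    rw [← Complex.exp_add]; ring_nf
  have hunit : ‖Complex.exp (ε * π * Complex.I)‖ = 1 := by
    rw [Complex.norm_exp]; simp
  have hRs := hR s hs
  rw [kernel_add_one m h h0s hs1 hnum hden hΓden, hphase]
  set Vs := (h 0 + 2 * s) * (∏ j ∈ Finset.range (m + 1), Complex.Gamma (h j + s)) * Complex.Gamma (-s) /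
      ∏ j ∈ Finset.range m, Complex.Gamma (1 + h 0 - h (j + 1) + s) with hVs
  set Rs := (h 0 + 2 * s + 2) / (h 0 + 2 * s) *
      ((∏ j ∈ Finset.range (m + 1), (h j + s)) / ((-s - 1) * ∏ j ∈ Finset.range m, (1 + h 0 - h (j + 1) + s))) with hRs_def
  set Es := Complex.exp (ε * π * Complex.I * s) with hEs
  set E1 := Complex.exp (ε * π * Complex.I) with hE1
  calc ‖Vs * Rs * (Es * E1)‖ = ‖Vs * Es‖ * ‖Rs‖ * ‖E1‖ := by
        rw [show Vs * Rs * (Es * E1) = (Vs * Es) * Rs * E1 by ring, norm_mul, norm_mul]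
    _ ≤ ‖Vs * Es‖ * (1 + δ) * 1 := by rw [hunit]; gcongr
    _ = (1 + δ) * ‖Vs * Es‖ := by ring

/-- **One step of the recursion for the line integrals**: for a pole-free line `Re s = x` beyond the threshold,
`∫ ‖V e^{iεπs}‖_{Re s = x+1} dy ≤ (1+δ) ∫ ‖V e^{iεπs}‖_{Re s = x} dy` (the right-hand side being finite under (5)). -/
theorem integral_norm_succ_le (m : ℕ) (h : ℕ → ℂ) {ε : ℝ} (hε : |ε| ≤ 1) {δ σ₀ : ℝ}
    (hT : 1 + (∑ j ∈ Finset.range (m + 1), ‖h j‖) + (∑ j ∈ Finset.range m, ‖1 + h 0 - h (j + 1)‖) < σ₀)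
    (hR : ∀ s : ℂ, σ₀ ≤ s.re →
        ‖(h 0 + 2 * s + 2) / (h 0 + 2 * s) *
            ((∏ j ∈ Finset.range (m + 1), (h j + s)) / ((-s - 1) * ∏ j ∈ Finset.range m, (1 + h 0 - h (j + 1) + s)))‖ ≤
          1 + δ)
    (h5 : 2 * (∑ j ∈ Finset.range m, (h (j + 1)).re) < ((m : ℝ) - 1) * (1 + (h 0).re))
    {x : ℝ} (hx : σ₀ ≤ x) (hxn : ∀ n : ℕ, x ≠ n) (hnum : ∀ j, j ≤ m → -(h j).re < x)
    (hden : ∀ j, j < m → -(1 + h 0 - h (j + 1)).re < x) :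
    ∫ y : ℝ, ‖(h 0 + 2 * (((x + 1 : ℝ) : ℂ) + (y : ℂ) * Complex.I)) *
              (∏ j ∈ Finset.range (m + 1), Complex.Gamma (h j + (((x + 1 : ℝ) : ℂ) + (y : ℂ) * Complex.I))) *
              Complex.Gamma (-(((x + 1 : ℝ) : ℂ) + (y : ℂ) * Complex.I)) /
            (∏ j ∈ Finset.range m, Complex.Gamma (1 + h 0 - h (j + 1) + (((x + 1 : ℝ) : ℂ) + (y : ℂ) * Complex.I))) *
          Complex.exp (ε * π * Complex.I * (((x + 1 : ℝ) : ℂ) + (y : ℂ) * Complex.I))‖ ≤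
      (1 + δ) * ∫ y : ℝ, ‖(h 0 + 2 * ((x : ℂ) + (y : ℂ) * Complex.I)) *
              (∏ j ∈ Finset.range (m + 1), Complex.Gamma (h j + ((x : ℂ) + (y : ℂ) * Complex.I))) *
              Complex.Gamma (-((x : ℂ) + (y : ℂ) * Complex.I)) /
            (∏ j ∈ Finset.range m, Complex.Gamma (1 + h 0 - h (j + 1) + ((x : ℂ) + (y : ℂ) * Complex.I))) *
          Complex.exp (ε * π * Complex.I * ((x : ℂ) + (y : ℂ) * Complex.I))‖ := by
  have hint := (integrable_integrand_line m h hε one_pos hxn hnum hden h5).norm.const_mul (1 + δ)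
  simp only [Complex.ofReal_one, Complex.one_cpow, mul_one] at hint
  rw [← integral_const_mul]
  refine integral_mono_of_nonneg (Eventually.of_forall fun y => norm_nonneg _) hint (Eventually.of_forall fun y => ?_)
  have hpt : ((x + 1 : ℝ) : ℂ) + (y : ℂ) * Complex.I = ((x : ℂ) + (y : ℂ) * Complex.I) + 1 := by push_cast; ring
  simp only [hpt]
  exact norm_kernel_phase_succ_le m h ε hT hR (by simp; exact hx)

/-! ### 3. The far line tends to zero -/

/-- **The far vertical line of the weighted Barnes integral of `F_m` vanishes in the limit**: for `Re h_j > 0` (`j ≤ m`),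
`Re(1+h₀−h_{j+1}) > 0` (`j < m`), Zudilin's (5), `|ε| ≤ 1` and `0 < w < 1`,
`∫ (V e^{iεπs} w^s)(N + ½ + iy) dy → 0` as `N → ∞` — by the ratio recursion, `w^N ∫‖V e^{iεπs}‖_{Re s = N+½}` decays
geometrically. -/
theorem tendsto_integral_far (m : ℕ) (h : ℕ → ℂ) (hpos : ∀ j, j ≤ m → 0 < (h j).re)
    (hden : ∀ j, j < m → 0 < (1 + h 0 - h (j + 1)).re)
    (h5 : 2 * (∑ j ∈ Finset.range m, (h (j + 1)).re) < ((m : ℝ) - 1) * (1 + (h 0).re))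
    (hε : |ε| ≤ 1) (hw : 0 < w) (hw1 : w < 1) :
    Tendsto (fun N : ℕ => ∫ y : ℝ,
        (h 0 + 2 * ((((N : ℝ) + 1 / 2 : ℝ) : ℂ) + (y : ℂ) * Complex.I)) *
                (∏ j ∈ Finset.range (m + 1), Complex.Gamma (h j + ((((N : ℝ) + 1 / 2 : ℝ) : ℂ) + (y : ℂ) * Complex.I))) *
                Complex.Gamma (-((((N : ℝ) + 1 / 2 : ℝ) : ℂ) + (y : ℂ) * Complex.I)) /
              (∏ j ∈ Finset.range m,
                Complex.Gamma (1 + h 0 - h (j + 1) + ((((N : ℝ) + 1 / 2 : ℝ) : ℂ) + (y : ℂ) * Complex.I))) *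
            Complex.exp (ε * π * Complex.I * ((((N : ℝ) + 1 / 2 : ℝ) : ℂ) + (y : ℂ) * Complex.I)) *
          (w : ℂ) ^ ((((N : ℝ) + 1 / 2 : ℝ) : ℂ) + (y : ℂ) * Complex.I)) atTop (𝓝 0) := by
  -- the line `Re s = N + ½` is pole-free
  have hbnat : ∀ N : ℕ, ∀ n : ℕ, (N : ℝ) + 1 / 2 ≠ n := fun N n hbn => by
    have := (Nat.cast_inj (R := ℝ)).mp (by push_cast; linarith : ((2 * N + 1 : ℕ) : ℝ) = ((2 * n : ℕ) : ℝ))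
    omega
  have hbnum : ∀ N : ℕ, ∀ j, j ≤ m → -(h j).re < (N : ℝ) + 1 / 2 := fun N j hj => by
    linarith [hpos j hj, N.cast_nonneg (α := ℝ)]
  have hbden : ∀ N : ℕ, ∀ j, j < m → -(1 + h 0 - h (j + 1)).re < (N : ℝ) + 1 / 2 := fun N j hj => by
    linarith [hden j hj, N.cast_nonneg (α := ℝ)]
  -- the norms on the far lines
  set J : ℕ → ℝ := fun N => ∫ y : ℝ, ‖(h 0 + 2 * ((((N : ℝ) + 1 / 2 : ℝ) : ℂ) + (y : ℂ) * Complex.I)) *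
              (∏ j ∈ Finset.range (m + 1), Complex.Gamma (h j + ((((N : ℝ) + 1 / 2 : ℝ) : ℂ) + (y : ℂ) * Complex.I))) *
              Complex.Gamma (-((((N : ℝ) + 1 / 2 : ℝ) : ℂ) + (y : ℂ) * Complex.I)) /
            (∏ j ∈ Finset.range m,
              Complex.Gamma (1 + h 0 - h (j + 1) + ((((N : ℝ) + 1 / 2 : ℝ) : ℂ) + (y : ℂ) * Complex.I))) *
          Complex.exp (ε * π * Complex.I * ((((N : ℝ) + 1 / 2 : ℝ) : ℂ) + (y : ℂ) * Complex.I))‖ with hJ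
  have hJ0 : ∀ N, 0 ≤ J N := fun N => integral_nonneg fun y => norm_nonneg _
  -- ratio control
  set δ : ℝ := (1 / w - 1) / 2 with hδ_def
  have hw' : 1 < 1 / w := by rw [lt_div_iff₀ hw]; linarith
  have hδ : 0 < δ := by rw [hδ_def]; linarith
  set ρ : ℝ := w * (1 + δ) with hρ_def
  have hρ : ρ = (1 + w) / 2 := by rw [hρ_def, hδ_def]; field_simp; ring
  have hρ0 : 0 < ρ := by rw [hρ]; linarith
  have hρ1 : ρ < 1 := by rw [hρ]; linarith
  obtain ⟨σ₀, hT, hR⟩ := exists_kernelRatio_le m h hδ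
  set N₀ : ℕ := ⌈σ₀⌉₊ with hN₀
  -- the recursion `J (N+1) ≤ (1+δ) J N` for `N ≥ N₀`
  have hrec : ∀ N : ℕ, N₀ ≤ N → J (N + 1) ≤ (1 + δ) * J N := by
    intro N hN
    have hσN : σ₀ ≤ (N : ℝ) + 1 / 2 := by
      have : σ₀ ≤ N₀ := Nat.le_ceil σ₀
      have : (N₀ : ℝ) ≤ N := by exact_mod_cast hN
      linarith
    have := integral_norm_succ_le m h hε hT hR h5 hσN (hbnat N) (hbnum N) (hbden N)
    have hcast : (((N + 1 : ℕ) : ℝ) + 1 / 2 : ℝ) = ((N : ℝ) + 1 / 2) + 1 := by push_cast; ring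
    simp only [hJ, hcast]
    exact this
  -- geometric decay of `w^N J N`
  have hgeom : ∀ N : ℕ, N₀ ≤ N → w ^ N * J N ≤ (w ^ N₀ * J N₀ / ρ ^ N₀) * ρ ^ N := by
    intro N hN
    induction N, hN using Nat.le_induction with
    | base => rw [div_mul_cancel₀ _ (pow_ne_zero _ hρ0.ne')]
    | succ N hN ih =>
      calc w ^ (N + 1) * J (N + 1) ≤ w ^ (N + 1) * ((1 + δ) * J N) :=
            mul_le_mul_of_nonneg_left (hrec N hN) (pow_nonneg hw.le _)
        _ = ρ * (w ^ N * J N) := by rw [hρ_def]; ring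
        _ ≤ ρ * ((w ^ N₀ * J N₀ / ρ ^ N₀) * ρ ^ N) := mul_le_mul_of_nonneg_left ih hρ0.le
        _ = (w ^ N₀ * J N₀ / ρ ^ N₀) * ρ ^ (N + 1) := by ring
  -- the far integral is bounded by `w^{1/2} · w^N J N`
  have hfar : ∀ N : ℕ, ‖∫ y : ℝ,
        (h 0 + 2 * ((((N : ℝ) + 1 / 2 : ℝ) : ℂ) + (y : ℂ) * Complex.I)) *
                (∏ j ∈ Finset.range (m + 1), Complex.Gamma (h j + ((((N : ℝ) + 1 / 2 : ℝ) : ℂ) + (y : ℂ) * Complex.I))) *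
                Complex.Gamma (-((((N : ℝ) + 1 / 2 : ℝ) : ℂ) + (y : ℂ) * Complex.I)) /
              (∏ j ∈ Finset.range m,
                Complex.Gamma (1 + h 0 - h (j + 1) + ((((N : ℝ) + 1 / 2 : ℝ) : ℂ) + (y : ℂ) * Complex.I))) *
            Complex.exp (ε * π * Complex.I * ((((N : ℝ) + 1 / 2 : ℝ) : ℂ) + (y : ℂ) * Complex.I)) *
          (w : ℂ) ^ ((((N : ℝ) + 1 / 2 : ℝ) : ℂ) + (y : ℂ) * Complex.I)‖ ≤ w ^ (1 / 2 : ℝ) * (w ^ N * J N) := by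
    intro N
    refine (norm_integral_le_integral_norm _).trans (le_of_eq ?_)
    have hpt : ∀ y : ℝ, ‖(h 0 + 2 * ((((N : ℝ) + 1 / 2 : ℝ) : ℂ) + (y : ℂ) * Complex.I)) *
                (∏ j ∈ Finset.range (m + 1), Complex.Gamma (h j + ((((N : ℝ) + 1 / 2 : ℝ) : ℂ) + (y : ℂ) * Complex.I))) *
                Complex.Gamma (-((((N : ℝ) + 1 / 2 : ℝ) : ℂ) + (y : ℂ) * Complex.I)) /
              (∏ j ∈ Finset.range m,
                Complex.Gamma (1 + h 0 - h (j + 1) + ((((N : ℝ) + 1 / 2 : ℝ) : ℂ) + (y : ℂ) * Complex.I))) *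
            Complex.exp (ε * π * Complex.I * ((((N : ℝ) + 1 / 2 : ℝ) : ℂ) + (y : ℂ) * Complex.I)) *
          (w : ℂ) ^ ((((N : ℝ) + 1 / 2 : ℝ) : ℂ) + (y : ℂ) * Complex.I)‖ =
        ‖(h 0 + 2 * ((((N : ℝ) + 1 / 2 : ℝ) : ℂ) + (y : ℂ) * Complex.I)) *
                (∏ j ∈ Finset.range (m + 1), Complex.Gamma (h j + ((((N : ℝ) + 1 / 2 : ℝ) : ℂ) + (y : ℂ) * Complex.I))) *
                Complex.Gamma (-((((N : ℝ) + 1 / 2 : ℝ) : ℂ) + (y : ℂ) * Complex.I)) /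
              (∏ j ∈ Finset.range m,
                Complex.Gamma (1 + h 0 - h (j + 1) + ((((N : ℝ) + 1 / 2 : ℝ) : ℂ) + (y : ℂ) * Complex.I))) *
            Complex.exp (ε * π * Complex.I * ((((N : ℝ) + 1 / 2 : ℝ) : ℂ) + (y : ℂ) * Complex.I))‖ *
          w ^ ((N : ℝ) + 1 / 2) := by
      intro y
      rw [norm_mul, norm_weight_eq hw]
      simp
    simp_rw [hpt]
    rw [integral_mul_const, Real.rpow_add hw, Real.rpow_natCast]
    simp only [hJ]
    ring
  -- conclusion
  have hlim : Tendsto (fun N : ℕ => w ^ (1 / 2 : ℝ) * ((w ^ N₀ * J N₀ / ρ ^ N₀) * ρ ^ N)) atTop (𝓝 0) := by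
    have := (tendsto_pow_atTop_nhds_zero_of_lt_one hρ0.le hρ1).const_mul (w ^ (1 / 2 : ℝ) * (w ^ N₀ * J N₀ / ρ ^ N₀))
    simpa [mul_assoc] using this
  refine squeeze_zero_norm' ?_ hlim
  rw [eventually_atTop]
  refine ⟨N₀, fun N hN => (hfar N).trans ?_⟩
  exact mul_le_mul_of_nonneg_left (hgeom N hN) (Real.rpow_nonneg hw.le _)

end Summit.KontsevichZagierPeriods.Zeta5Search.VWPBarnesFarLine

end
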